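import Summits.BirchSwinnertonDyer.BirchSwinnertonDyer.Theses.ShaPrimaryTransfer
import Literature.NumberTheory.EllipticCurves.KubertTate133GaussianDescent
import HarnessLib

/-!
# BirchSwinnertonDyer / ShaPrimaryTransfer — crux `FiniteShaComponentTransfer` (stmt-BirchSwinnertonDyer-22356):
# AN UNCONDITIONAL DOOR AT 5 ON A RANK-1 CURVE WITHOUT RATIONAL 5-TORSION — the twist `E_{13/3}^{(-4)}`

Helper file of prover seat `bsd-line-spt-p1` g21 (`--supports stmt-22356 --as helper`). THEOREMS ONLY. The tree's
`Literature/…/KubertTate133GaussianDescent` runs the complete `5`-isogeny descent of `E_{13/3} = [-10, -39, -117, 0, 0]` over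
`ℚ(i)` at THREE places — the inert `(3)` and the conjugate pair `(2 ± 3ζ₄)` above the split prime `13 ∣ mn` — with a box filled
by two `ℚ`-points and one `ℚ(i)`-point coming from the twist (`rank E(ℚ(i)) = 2`, `Ш(E ⊗ ℚ(i))[5] = 0`), and descends to the
quadratic twist `E_{13/3}^{(-4)}/ℚ` (`≅ E^{(-1)}`; NO rational `5`-torsion point): **`rank E^{(-4)}(ℚ) = 1` and
`t₅(E^{(-4)}) = 0`**, by descent alone (no `L`-value, no Gross–Zagier–Kolyvagin).  Read in the route's currency:

* `shaCorank_five_twist_eq_zero` — `t₅(E_{13/3}^{(-4)}) = 0`; `mordellWeilRank_twist_eq_one` — rank `1`;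
* `oneFiniteShaComponent_twist` — O for the twist with witness `p₀ = 5`;
* `transfer_twist` — **T BY NAME** on the twist; `transfer_iff_twist` — T's content on this curve is «`t_q = 0` for all `q`».

Second row (after `…GaussianTwistDoor14613`, rank `2`) of the Gaussian-twist table. T is UNCHANGED (conjecture-grade at
analytic rank ≥ 2) and BSD is NOT proved by any of this.

## References

* [SilvermanAEC2009] J. H. Silverman, *AEC*, 2nd ed., Thm. X.4.2, Exercise 10.16.
* [Fisher2001FiveSevenDescent] T. Fisher, JEMS 3 (2001), §§1–2.
-/

-- D-0017: single-problem summit, so `Summit.BirchSwinnertonDyer.BirchSwinnertonDyer.…` repeats a namespace BY DESIGN.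
set_option linter.dupNamespace false
set_option autoImplicit false

noncomputable section

open scoped Classical
open Literature.NumberTheory.EllipticCurves WeierstrassCurve
open Summit.BirchSwinnertonDyer.BirchSwinnertonDyer.Theses.ShaPrimaryTransfer

namespace Summit.BirchSwinnertonDyer.BirchSwinnertonDyer.Theorems.ShaPrimaryTransferGaussianTwistDoor133

/-- The twist `E_{13/3}^{(-4)}` is elliptic (`-4 ≠ 0`). [cite: SilvermanAEC2009, X.§2] -/
theorem isElliptic_twist :
    haveI := KubertTate133Descent.isElliptic
    ((kubertTateFive (((13 : ℤ) : ℚ)) (((3 : ℤ) : ℚ))).quadraticTwist (-4)).IsElliptic := by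
  haveI := KubertTate133Descent.isElliptic
  exact isElliptic_quadraticTwist _ (by norm_num)

/-- **`t₅(E_{13/3}^{(-4)}/ℚ) = 0`, unconditionally** (descent over `ℚ(i) = CyclotomicField 4 ℚ`; tree
`KubertTate133GaussianDescent.shaCorank_five_twist_eq_zero`). [cite: SilvermanAEC2009, Thm. X.4.2 and Exercise 10.16]
[cite: Fisher2001FiveSevenDescent, §2] -/
theorem shaCorank_five_twist_eq_zero :
    haveI := KubertTate133Descent.isElliptic
    haveI := isElliptic_twist
    ((kubertTateFive (((13 : ℤ) : ℚ)) (((3 : ℤ) : ℚ))).quadraticTwist (-4)).shaCorank 5 = 0 := by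
  haveI := KubertTate133Descent.isElliptic
  haveI := isElliptic_twist
  haveI : IsCyclotomicExtension {4} ℚ (CyclotomicField 4 ℚ) := CyclotomicField.isCyclotomicExtension 4 ℚ
  exact KubertTate133GaussianDescent.shaCorank_five_twist_eq_zero (CyclotomicField 4 ℚ)

/-- **`rank E_{13/3}^{(-4)}(ℚ) = 1`, unconditionally** — a rank-`1` curve over `ℚ` without rational `5`-torsion whose
`5`-primary Tate–Shafarevich group has corank `0` by descent alone. [cite: SilvermanAEC2009, Exercise 10.16] -/
theorem mordellWeilRank_twist_eq_one :
    haveI := KubertTate133Descent.isElliptic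
    haveI := isElliptic_twist
    ((kubertTateFive (((13 : ℤ) : ℚ)) (((3 : ℤ) : ℚ))).quadraticTwist (-4)).mordellWeilRank = 1 := by
  haveI := KubertTate133Descent.isElliptic
  haveI := isElliptic_twist
  haveI : IsCyclotomicExtension {4} ℚ (CyclotomicField 4 ℚ) := CyclotomicField.isCyclotomicExtension 4 ℚ
  exact KubertTate133GaussianDescent.mordellWeilRank_twist_eq_one (CyclotomicField 4 ℚ)

/-- **O for `E_{13/3}^{(-4)}` with witness `p₀ = 5`** (the route's `OneFiniteShaComponent` shape, unconditional, on a rank-`1`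
curve without rational `5`-torsion). [cite: SilvermanAEC2009, Thm. X.4.2] -/
theorem oneFiniteShaComponent_twist :
    haveI := KubertTate133Descent.isElliptic
    haveI := isElliptic_twist
    ∃ (p : ℕ) (_ : Fact p.Prime), ((kubertTateFive (((13 : ℤ) : ℚ)) (((3 : ℤ) : ℚ))).quadraticTwist (-4)).shaCorank p = 0 :=
  ⟨5, ⟨Nat.prime_five⟩, shaCorank_five_twist_eq_zero⟩

/-- **T BY NAME on `E_{13/3}^{(-4)}`**: granting `FiniteShaComponentTransfer`, every primary component of
`Ш(E_{13/3}^{(-4)}/ℚ)` has corank `0` — an instance of T's load-bearing slice (rank `1`; door `5`; no rational `5`-torsion) fed by an unconditional door. T itself is NOT proved.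
[cite: SilvermanAEC2009, Thm. X.4.2] -/
theorem transfer_twist (hT : FiniteShaComponentTransfer) (q : ℕ) [Fact q.Prime] :
    haveI := KubertTate133Descent.isElliptic
    haveI := isElliptic_twist
    ((kubertTateFive (((13 : ℤ) : ℚ)) (((3 : ℤ) : ℚ))).quadraticTwist (-4)).shaCorank q = 0 := by
  haveI := KubertTate133Descent.isElliptic
  haveI := isElliptic_twist
  haveI : Fact (Nat.Prime 5) := ⟨Nat.prime_five⟩
  exact hT _ 5 q shaCorank_five_twist_eq_zero

/-- **What T says about this curve, exactly**: since the door at `5` is open unconditionally, the instance of T at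
`E_{13/3}^{(-4)}` (all `p → q` transfers) is EQUIVALENT to «`t_q(E_{13/3}^{(-4)}) = 0` for every prime `q`» — the
remaining content is the transfer `5 → q`, `q ≠ 5` (open). [cite: SilvermanAEC2009, Thm. X.4.2] -/
theorem transfer_iff_twist :
    haveI := KubertTate133Descent.isElliptic
    haveI := isElliptic_twist
    (∀ (p q : ℕ) [Fact p.Prime] [Fact q.Prime],
        ((kubertTateFive (((13 : ℤ) : ℚ)) (((3 : ℤ) : ℚ))).quadraticTwist (-4)).shaCorank p = 0 →
          ((kubertTateFive (((13 : ℤ) : ℚ)) (((3 : ℤ) : ℚ))).quadraticTwist (-4)).shaCorank q = 0) ↔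
      ∀ (q : ℕ) [Fact q.Prime], ((kubertTateFive (((13 : ℤ) : ℚ)) (((3 : ℤ) : ℚ))).quadraticTwist (-4)).shaCorank q = 0 := by
  haveI := KubertTate133Descent.isElliptic
  haveI := isElliptic_twist
  haveI : Fact (Nat.Prime 5) := ⟨Nat.prime_five⟩
  constructor
  · intro h q _
    exact h 5 q shaCorank_five_twist_eq_zero
  · intro h p q _ _ _
    exact h q

end Summit.BirchSwinnertonDyer.BirchSwinnertonDyer.Theorems.ShaPrimaryTransferGaussianTwistDoor133

end
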